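import Mathlib
import HarnessLib
import Literature.MathematicalPhysics.QuantumFieldTheory.ConstructiveQFTWave0
import Summits.QuantumFields.GaugeBoot.LatticeWords
import Summits.Ventures.LatticeQCDFlow.Scaling.GaugeForestTrivial
import Summits.Ventures.LatticeQCDFlow.Scaling.GaugeCycleHolonomy

/-!
# LatticeQCDFlow / Scaling — gauge classes on a cycle with forests hanging off it, on two cycles
# through a point and on a bouquet: the invariant is the JOINT conjugacy class of the holonomies

HONEST FRAMING: exact (Metropolis-corrected) sampling algorithms for lattice gauge theory;
figures of merit are autocorrelation/cost numbers at stated couplings and volumes; no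
continuum-physics claim.

Venture `LatticeQCDFlow` (cell pub-lqcd), topic `Scaling`, FANOUT row 30 (lean-1, GEN-16) — OUR WORK,
sequel of `Scaling/GaugeCycleHolonomy` (word holonomies are gauge covariant; the EAR LEMMA; on a
simple cycle two configurations are gauge related iff their holonomies are conjugate) and of
`Scaling/GaugeForestTrivial` (forests are gauge trivial, pruning certificates).  Configuration level,
every group `G`, every `d`, `L`; same conventions (visited sites `w.scanl Step.apply x`, traversed
links `List.zipWith Step.edge (w.scanl Step.apply x) w`, pruning certificates as lists of
(link, private endpoint) pairs).

* §1 **`exists_gaugeTransform_extend_forest`** — extend a gauge transformation over a pruning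
  certificate KEEPING a given `γ₀` away from the private endpoints (the tree's
  `exists_gaugeTransform_eq_on_forest` is the case without `γ₀`); hence
  **`exists_gaugeTransform_eq_on_cycle_forest`** (closed simple word + pruning certificate whose
  private endpoints are off the cycle: `hol(U') = k · hol(U) · k⁻¹` ⇒ gauge related on cycle ∪ forest
  by a `γ` with `γ(x) = k`) and `exists_gaugeTransform_eq_on_path_forest` (open simple path + such a
  forest: ANY two configurations are gauge related — the whole link set is a forest).
* §2 **`gaugeRelated_on_cycle_forest_iff`** — a forest hanging off the cycle carries no further
  invariant: gauge related on cycle ∪ forest iff the cycle holonomies are conjugate;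
  **`gaugeRelated_on_two_cycles_iff`** — two simple cycles through `x` meeting only at `x` (a figure
  eight, i.e. an ear decomposition with two ears): gauge related on the union iff ONE `k` conjugates
  BOTH holonomies simultaneously.  The invariant of several cycles is the JOINT conjugacy class of the
  tuple of based holonomies — strictly finer than the tuple of conjugacy classes for non-abelian `G`.
* §3 A BOUQUET of closed simple words through `x` pairwise meeting only at `x`:
  `exists_gaugeTransform_eq_on_bouquet` (one `k` conjugating every petal holonomy ⇒ gauge related on
  all petals by a `γ` with `γ(x) = k`, induction on the petals by the ear lemma),
  **`gaugeRelated_on_bouquet_iff`**, and `exists_gaugeTransform_eq_on_bouquet_path` (one more OPEN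
  petal — a simple path ending at `x` — adds no invariant: the retained structure just before a
  further cycle through `x` is closed).

READING (value-free, THEORY-2 §4 C5 / T2-AF, autoregressive context in link variables): with
GEN-15's master identity (`coordAvg_eq_of_gaugeRelated_off`) these give, at the measure level (the
sequel over `Scaling/AutoregressiveGaugeRedundancy`), that the exact conditional of a cycle-closing
link given a retained unicyclic structure is a class function of the cycle holonomy, the dangling
forests being invisible; and that once several cycles through the retained structure are closed the
conditional reads at most the joint conjugacy class of their holonomies.  NOT CLAIMED: the general
ear-decomposition induction (only the two-ear case is assembled; the ear lemma of the parent file is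
the general step); any lower bound; any number of ours.  Nearest prints as in the parent file (gauge
orbits on a finite graph `= G^E/G^V`, based holonomies modulo simultaneous conjugation: Giles 1981,
Baez 1996 §2, Gambini–Pullin 1996 Ch. 1; maximal trees: Creutz 1983 Ch. 9).  No definition is
introduced; nothing is cited as a fact; no `sorry`.
-/

noncomputable section

namespace Summit.Ventures.LatticeQCDFlow.Theory2.Autoregressive

open Function
open Literature.MathematicalPhysics.QuantumFieldTheory
open Summit.QuantumFields.GaugeBoot

variable {d L : ℕ} {G : Type*} [Group G]

/-! ## §1 Forests hanging off: extending a gauge transformation over a pruning certificate -/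

/-- **Extending a gauge transformation over a forest, keeping it elsewhere.**  For a pruning
certificate `T` (as in the tree's `exists_gaugeTransform_eq_on_forest`: a list of (link, site)
pairs, each link not a loop, the site one of its endpoints, touched by no LATER link of the list),
any `γ₀` and any `U, U'`: some `γ` that AGREES WITH `γ₀` AWAY FROM THE PRIVATE ENDPOINTS of `T` maps
`U` to `U'` on every link of `T`. [ours] -/
theorem exists_gaugeTransform_extend_forest (γ₀ : Site d L → G) (U U' : GaugeConfig d L G) :
    ∀ (T : List (Edge d L × Site d L)),
      (∀ q ∈ T, (q.1.1 = q.2 ∨ q.1.1.shift q.1.2 = q.2) ∧ q.1.1 ≠ q.1.1.shift q.1.2) →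
      T.Pairwise (fun q r => ¬ (r.1.1 = q.2 ∨ r.1.1.shift r.1.2 = q.2)) →
      ∃ γ : Site d L → G, (∀ y, (∀ q ∈ T, q.2 ≠ y) → γ y = γ₀ y) ∧
        ∀ q ∈ T, gaugeTransform γ U q.1 = U' q.1
  | [], _, _ => ⟨γ₀, fun _ _ => rfl, by simp⟩
  | q :: T, hinc, hpw => by
    obtain ⟨hq, hpw'⟩ := List.pairwise_cons.1 hpw
    obtain ⟨γ', hγ'₀, hγ'⟩ := exists_gaugeTransform_extend_forest γ₀ U U' T
      (fun r hr => hinc r (List.mem_cons_of_mem _ hr)) hpw'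
    obtain ⟨hqinc, hqloop⟩ := hinc q List.mem_cons_self
    obtain ⟨g, hg⟩ := exists_update_gaugeTransform_apply_eq γ' U hqinc hqloop (U' q.1)
    refine ⟨update γ' q.2 g, fun y hy => ?_, fun r hr => ?_⟩
    · rw [update_of_ne (hy q List.mem_cons_self).symm]
      exact hγ'₀ y fun r hr => hy r (List.mem_cons_of_mem _ hr)
    · rcases List.mem_cons.1 hr with rfl | hr'
      · exact hg
      · have hni := hq r hr'
        rw [gaugeTransform_update_apply_of_not_incident γ' q.2 g U (fun h1 => hni (Or.inl h1))
          (fun h2 => hni (Or.inr h2))]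
        exact hγ' r hr'

/-- **Cycle with a forest hanging off it.**  A closed simple word `s :: p` from `x`, and a pruning
certificate `T` whose private endpoints are NOT on the cycle (peel the trees towards the cycle).
If `hol(U') = k · hol(U) · k⁻¹` then some `γ` with `γ(x) = k` maps `U` to `U'` on every link of the
cycle AND on every link of `T`. [ours] -/
theorem exists_gaugeTransform_eq_on_cycle_forest (U U' : GaugeConfig d L G) (x : Site d L)
    (s : Step d) (p : Word d) (hclosed : Word.endpoint x (s :: p) = x)
    (hnd : (p.scanl Step.apply (s.apply x)).Nodup) (T : List (Edge d L × Site d L))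
    (hinc : ∀ q ∈ T, (q.1.1 = q.2 ∨ q.1.1.shift q.1.2 = q.2) ∧ q.1.1 ≠ q.1.1.shift q.1.2)
    (hpw : T.Pairwise (fun q r => ¬ (r.1.1 = q.2 ∨ r.1.1.shift r.1.2 = q.2)))
    (hoff : ∀ q ∈ T, q.2 ∉ (s :: p).scanl Step.apply x) (k : G)
    (hhol : wordHolonomy U' x (s :: p) = k * wordHolonomy U x (s :: p) * k⁻¹) :
    ∃ γ : Site d L → G, γ x = k ∧
      (∀ e ∈ List.zipWith Step.edge ((s :: p).scanl Step.apply x) (s :: p),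
        gaugeTransform γ U e = U' e) ∧
      ∀ q ∈ T, gaugeTransform γ U q.1 = U' q.1 := by
  obtain ⟨γ₀, hγ₀k, -, hγ₀⟩ := exists_gaugeTransform_eq_on_cycle U U' x s p hclosed hnd k hhol
  obtain ⟨γ, hγγ₀, hγT⟩ := exists_gaugeTransform_extend_forest γ₀ U U' T hinc hpw
  have hfix : ∀ y ∈ (s :: p).scanl Step.apply x, γ y = γ₀ y :=
    fun y hy => hγγ₀ y fun q hq h => hoff q hq (by rw [h]; exact hy)
  refine ⟨γ, ?_, fun e he => ?_, hγT⟩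
  · rw [hfix x (start_mem_scanl x _), hγ₀k]
  · obtain ⟨h1, h2⟩ := endpoints_mem_scanl_of_mem_zipWith x (s :: p) he
    rw [gaugeTransform_congr_endpoints U (hfix _ h1) (hfix _ h2)]
    exact hγ₀ e he

/-- **Open path with a forest hanging off it** (no holonomy condition: the whole link set is a
forest): ANY two configurations are gauge related on the links of a simple open word `w` from `x`
and of a pruning certificate `T` whose private endpoints avoid the sites of `w`. [ours] -/
theorem exists_gaugeTransform_eq_on_path_forest (U U' : GaugeConfig d L G) (w : Word d)
    (x : Site d L) (hnd : (w.scanl Step.apply x).Nodup) (T : List (Edge d L × Site d L))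
    (hinc : ∀ q ∈ T, (q.1.1 = q.2 ∨ q.1.1.shift q.1.2 = q.2) ∧ q.1.1 ≠ q.1.1.shift q.1.2)
    (hpw : T.Pairwise (fun q r => ¬ (r.1.1 = q.2 ∨ r.1.1.shift r.1.2 = q.2)))
    (hoff : ∀ q ∈ T, q.2 ∉ w.scanl Step.apply x) :
    ∃ γ : Site d L → G,
      (∀ e ∈ List.zipWith Step.edge (w.scanl Step.apply x) w, gaugeTransform γ U e = U' e) ∧
      ∀ q ∈ T, gaugeTransform γ U q.1 = U' q.1 := by
  obtain ⟨γ₀, -, hγ₀⟩ := exists_gaugeTransform_eq_on_path U U' w x 1 hnd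
  obtain ⟨γ, hγγ₀, hγT⟩ := exists_gaugeTransform_extend_forest γ₀ U U' T hinc hpw
  have hfix : ∀ y ∈ w.scanl Step.apply x, γ y = γ₀ y :=
    fun y hy => hγγ₀ y fun q hq h => hoff q hq (by rw [h]; exact hy)
  refine ⟨γ, fun e he => ?_, hγT⟩
  obtain ⟨h1, h2⟩ := endpoints_mem_scanl_of_mem_zipWith x w he
  rw [gaugeTransform_congr_endpoints U (hfix _ h1) (hfix _ h2)]
  exact hγ₀ e he

/-! ## §2 The classification with forests; two cycles through a point -/

/-- **A forest hanging off the cycle carries no further invariant**: with a pruning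
certificate `T` off the cycle, gauge related on cycle ∪ `T` iff the cycle holonomies are conjugate.
[ours] -/
theorem gaugeRelated_on_cycle_forest_iff (U U' : GaugeConfig d L G) (x : Site d L) (s : Step d)
    (p : Word d) (hclosed : Word.endpoint x (s :: p) = x)
    (hnd : (p.scanl Step.apply (s.apply x)).Nodup) (T : List (Edge d L × Site d L))
    (hinc : ∀ q ∈ T, (q.1.1 = q.2 ∨ q.1.1.shift q.1.2 = q.2) ∧ q.1.1 ≠ q.1.1.shift q.1.2)
    (hpw : T.Pairwise (fun q r => ¬ (r.1.1 = q.2 ∨ r.1.1.shift r.1.2 = q.2)))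
    (hoff : ∀ q ∈ T, q.2 ∉ (s :: p).scanl Step.apply x) :
    (∃ γ : Site d L → G,
        (∀ e ∈ List.zipWith Step.edge ((s :: p).scanl Step.apply x) (s :: p),
          gaugeTransform γ U e = U' e) ∧ ∀ q ∈ T, gaugeTransform γ U q.1 = U' q.1) ↔
      IsConj (wordHolonomy U x (s :: p)) (wordHolonomy U' x (s :: p)) := by
  rw [isConj_iff]
  constructor
  · rintro ⟨γ, hγ, -⟩
    exact ⟨γ x, (wordHolonomy_eq_conj_of_eqOn hclosed hγ).symm⟩
  · rintro ⟨k, hk⟩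
    obtain ⟨γ, -, hγ⟩ :=
      exists_gaugeTransform_eq_on_cycle_forest U U' x s p hclosed hnd T hinc hpw hoff k hk.symm
    exact ⟨γ, hγ⟩

/-- **TWO CYCLES THROUGH ONE POINT: the invariant is the JOINT conjugacy class of the PAIR of
holonomies** (not the two classes separately).  Closed simple words `s₁ :: p₁` and `s₂ :: p₂` from
`x`, the second meeting the first only at `x` (a figure eight; an ear decomposition with two ears).
Two configurations are gauge related on the union iff ONE `k` conjugates both holonomies
simultaneously (cycle lemma for the first, ear lemma for the second, started from the first's `γ`).
[ours] -/
theorem gaugeRelated_on_two_cycles_iff (U U' : GaugeConfig d L G) (x : Site d L)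
    (s₁ : Step d) (p₁ : Word d) (s₂ : Step d) (p₂ : Word d)
    (h₁c : Word.endpoint x (s₁ :: p₁) = x) (h₁n : (p₁.scanl Step.apply (s₁.apply x)).Nodup)
    (h₂c : Word.endpoint x (s₂ :: p₂) = x) (h₂n : (p₂.scanl Step.apply (s₂.apply x)).Nodup)
    (hmeet : ∀ y ∈ p₂.scanl Step.apply (s₂.apply x), y ∈ (s₁ :: p₁).scanl Step.apply x → y = x) :
    (∃ γ : Site d L → G,
        (∀ e ∈ List.zipWith Step.edge ((s₁ :: p₁).scanl Step.apply x) (s₁ :: p₁),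
          gaugeTransform γ U e = U' e) ∧
        ∀ e ∈ List.zipWith Step.edge ((s₂ :: p₂).scanl Step.apply x) (s₂ :: p₂),
          gaugeTransform γ U e = U' e) ↔
      ∃ k : G, wordHolonomy U' x (s₁ :: p₁) = k * wordHolonomy U x (s₁ :: p₁) * k⁻¹ ∧
        wordHolonomy U' x (s₂ :: p₂) = k * wordHolonomy U x (s₂ :: p₂) * k⁻¹ := by
  constructor
  · rintro ⟨γ, hγ₁, hγ₂⟩
    exact ⟨γ x, wordHolonomy_eq_conj_of_eqOn h₁c hγ₁, wordHolonomy_eq_conj_of_eqOn h₂c hγ₂⟩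
  · rintro ⟨k, hk₁, hk₂⟩
    obtain ⟨γ₁, hγ₁x, -, hγ₁⟩ := exists_gaugeTransform_eq_on_cycle U U' x s₁ p₁ h₁c h₁n k hk₁
    have hx₂ : x ∉ p₂.scanl Step.apply (s₂.apply x) ∨ x = Word.endpoint (s₂.apply x) p₂ :=
      Or.inr (by rw [Word.endpoint_cons] at h₂c; exact h₂c.symm)
    have hhol₂ : wordHolonomy U' x (s₂ :: p₂) =
        γ₁ x * wordHolonomy U x (s₂ :: p₂) * (γ₁ (Word.endpoint x (s₂ :: p₂)))⁻¹ := by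
      rw [h₂c, hγ₁x]; exact hk₂
    obtain ⟨γ, hoff, -, hγx, hγ₂⟩ := exists_gaugeTransform_ear γ₁ U U' x s₂ p₂ h₂n hx₂ hhol₂
    -- `γ = γ₁` on the sites of the first cycle (they meet the second only at `x`)
    have hfix : ∀ y ∈ (s₁ :: p₁).scanl Step.apply x, γ y = γ₁ y := by
      intro y hy
      by_cases hy₂ : y ∈ p₂.scanl Step.apply (s₂.apply x)
      · rw [hmeet y hy₂ hy]; exact hγx
      · exact hoff y hy₂
    refine ⟨γ, fun e he => ?_, hγ₂⟩
    obtain ⟨h1, h2⟩ := endpoints_mem_scanl_of_mem_zipWith x (s₁ :: p₁) he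
    rw [gaugeTransform_congr_endpoints U (hfix _ h1) (hfix _ h2)]
    exact hγ₁ e he

/-! ## §3 A bouquet of cycles through a point: the joint conjugacy class of the tuple -/

/-- **Joint conjugacy ⇒ gauge related on a whole bouquet, with the conjugator as the value at the
base point.**  Let `C` be a list of closed simple words `c.1 :: c.2` from `x`, pairwise meeting only
at `x` (every site visited after `x` by one petal that is also visited by another petal is `x`).
If ONE `k` conjugates all the petal holonomies of `U` into those of `U'`, some `γ` with `γ(x) = k`
maps `U` to `U'` on every link of every petal (induction on the petals: the ear lemma started from
the current `γ`, whose value `k` at `x` never changes). [ours] -/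
theorem exists_gaugeTransform_eq_on_bouquet (U U' : GaugeConfig d L G) (x : Site d L) (k : G) :
    ∀ (C : List (Step d × Word d)), (∀ c ∈ C, Word.endpoint x (c.1 :: c.2) = x) →
      (∀ c ∈ C, (c.2.scanl Step.apply (c.1.apply x)).Nodup) →
      C.Pairwise (fun c c' => ∀ y ∈ c'.2.scanl Step.apply (c'.1.apply x),
        y ∈ (c.1 :: c.2).scanl Step.apply x → y = x) →
      (∀ c ∈ C, wordHolonomy U' x (c.1 :: c.2) = k * wordHolonomy U x (c.1 :: c.2) * k⁻¹) →
      ∃ γ : Site d L → G, γ x = k ∧ ∀ c ∈ C,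
        ∀ e ∈ List.zipWith Step.edge ((c.1 :: c.2).scanl Step.apply x) (c.1 :: c.2),
          gaugeTransform γ U e = U' e
  | [], _, _, _, _ => ⟨fun _ => k, rfl, fun c hc => absurd hc (by simp)⟩
  | c :: C, hclosed, hnd, hmeet, hk => by
    obtain ⟨hcC, hmeet'⟩ := List.pairwise_cons.1 hmeet
    obtain ⟨γ', hγ'x, hγ'⟩ := exists_gaugeTransform_eq_on_bouquet U U' x k C
      (fun c' hc' => hclosed c' (List.mem_cons_of_mem _ hc'))
      (fun c' hc' => hnd c' (List.mem_cons_of_mem _ hc')) hmeet'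
      (fun c' hc' => hk c' (List.mem_cons_of_mem _ hc'))
    have hcc := hclosed c List.mem_cons_self
    have hx : x ∉ c.2.scanl Step.apply (c.1.apply x) ∨ x = Word.endpoint (c.1.apply x) c.2 :=
      Or.inr (by rw [Word.endpoint_cons] at hcc; exact hcc.symm)
    have hhol : wordHolonomy U' x (c.1 :: c.2) =
        γ' x * wordHolonomy U x (c.1 :: c.2) * (γ' (Word.endpoint x (c.1 :: c.2)))⁻¹ := by
      rw [hcc, hγ'x]; exact hk c List.mem_cons_self
    obtain ⟨γ, hoff, -, hγx, hγc⟩ :=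
      exists_gaugeTransform_ear γ' U U' x c.1 c.2 (hnd c List.mem_cons_self) hx hhol
    refine ⟨γ, hγx.trans hγ'x, fun c' hc' => ?_⟩
    rcases List.mem_cons.1 hc' with rfl | hc'C
    · exact hγc
    · -- `γ = γ'` on the sites of the petal `c'` (it meets the new petal only at `x`)
      have hfix : ∀ y ∈ (c'.1 :: c'.2).scanl Step.apply x, γ y = γ' y := by
        intro y hy
        by_cases hyc : y ∈ c.2.scanl Step.apply (c.1.apply x)
        · have hyx : y = x := by
            rw [scanl_apply_cons, List.mem_cons] at hy
            rcases hy with rfl | hy'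
            · rfl
            · exact hcC c' hc'C y hy' (by
                rw [scanl_apply_cons]; exact List.mem_cons_of_mem _ hyc)
          rw [hyx]; exact hγx
        · exact hoff y hyc
      intro e he
      obtain ⟨h1, h2⟩ := endpoints_mem_scanl_of_mem_zipWith x (c'.1 :: c'.2) he
      rw [gaugeTransform_congr_endpoints U (hfix _ h1) (hfix _ h2)]
      exact hγ' c' hc'C e he

/-- **A BOUQUET OF CYCLES: the invariant is the JOINT conjugacy class of the TUPLE of holonomies.**
Two configurations are gauge related on all the petals of a bouquet through `x` iff ONE `k`
conjugates ALL the holonomies simultaneously. [ours] -/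
theorem gaugeRelated_on_bouquet_iff (U U' : GaugeConfig d L G) (x : Site d L)
    (C : List (Step d × Word d)) (hclosed : ∀ c ∈ C, Word.endpoint x (c.1 :: c.2) = x)
    (hnd : ∀ c ∈ C, (c.2.scanl Step.apply (c.1.apply x)).Nodup)
    (hmeet : C.Pairwise (fun c c' => ∀ y ∈ c'.2.scanl Step.apply (c'.1.apply x),
      y ∈ (c.1 :: c.2).scanl Step.apply x → y = x)) :
    (∃ γ : Site d L → G, ∀ c ∈ C,
        ∀ e ∈ List.zipWith Step.edge ((c.1 :: c.2).scanl Step.apply x) (c.1 :: c.2),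
          gaugeTransform γ U e = U' e) ↔
      ∃ k : G, ∀ c ∈ C,
        wordHolonomy U' x (c.1 :: c.2) = k * wordHolonomy U x (c.1 :: c.2) * k⁻¹ := by
  constructor
  · rintro ⟨γ, hγ⟩
    exact ⟨γ x, fun c hc => wordHolonomy_eq_conj_of_eqOn (hclosed c hc) (hγ c hc)⟩
  · rintro ⟨k, hk⟩
    obtain ⟨γ, -, hγ⟩ := exists_gaugeTransform_eq_on_bouquet U U' x k C hclosed hnd hmeet hk
    exact ⟨γ, hγ⟩

/-- **A bouquet with one more OPEN petal (a simple path ending at `x`, otherwise off the bouquet):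
the open petal adds no invariant.**  If ONE `k` conjugates all the closed petals' holonomies, some
`γ` with `γ(x) = k` maps `U` to `U'` on every closed petal AND on the open path `w` from `y` to `x`
(transport along `w` keeping the bouquet's `γ`, whose end value at `x` is kept). This is the
retained structure just BEFORE a further cycle through `x` is closed. [ours] -/
theorem exists_gaugeTransform_eq_on_bouquet_path (U U' : GaugeConfig d L G) (x : Site d L) (k : G)
    (C : List (Step d × Word d)) (hclosed : ∀ c ∈ C, Word.endpoint x (c.1 :: c.2) = x)
    (hnd : ∀ c ∈ C, (c.2.scanl Step.apply (c.1.apply x)).Nodup)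
    (hmeet : C.Pairwise (fun c c' => ∀ y ∈ c'.2.scanl Step.apply (c'.1.apply x),
      y ∈ (c.1 :: c.2).scanl Step.apply x → y = x))
    (w : Word d) (y : Site d L) (hwnd : (w.scanl Step.apply y).Nodup)
    (hwend : Word.endpoint y w = x)
    (hwmeet : ∀ z ∈ w.scanl Step.apply y, ∀ c ∈ C, z ∈ (c.1 :: c.2).scanl Step.apply x → z = x)
    (hk : ∀ c ∈ C, wordHolonomy U' x (c.1 :: c.2) = k * wordHolonomy U x (c.1 :: c.2) * k⁻¹) :
    ∃ γ : Site d L → G, γ x = k ∧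
      (∀ c ∈ C, ∀ e ∈ List.zipWith Step.edge ((c.1 :: c.2).scanl Step.apply x) (c.1 :: c.2),
        gaugeTransform γ U e = U' e) ∧
      ∀ e ∈ List.zipWith Step.edge (w.scanl Step.apply y) w, gaugeTransform γ U e = U' e := by
  obtain ⟨γ', hγ'x, hγ'⟩ := exists_gaugeTransform_eq_on_bouquet U U' x k C hclosed hnd hmeet hk
  obtain ⟨γ, hoff, hend, hγw⟩ := exists_gaugeTransform_eq_on_path_keep γ' U U' w y hwnd
  rw [hwend] at hend
  have hfix : ∀ c ∈ C, ∀ z ∈ (c.1 :: c.2).scanl Step.apply x, γ z = γ' z := by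
    intro c hc z hz
    by_cases hzw : z ∈ w.scanl Step.apply y
    · rw [hwmeet z hzw c hc hz]; exact hend
    · exact hoff z hzw
  refine ⟨γ, hend.trans hγ'x, fun c hc e he => ?_, hγw⟩
  obtain ⟨h1, h2⟩ := endpoints_mem_scanl_of_mem_zipWith x (c.1 :: c.2) he
  rw [gaugeTransform_congr_endpoints U (hfix c hc _ h1) (hfix c hc _ h2)]
  exact hγ' c hc e he

end Summit.Ventures.LatticeQCDFlow.Theory2.Autoregressive

end
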